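import Mathlib
import Literature.Analysis.SpecialFunctions.GaussLegendreQuadrature
import HarnessLib

/-!
# Integration formulas of interpolatory type; the closed Newton–Cotes weights
(Davis–Rabinowitz, *Methods of Numerical Integration*, 2nd ed. 1984, Sect. 2.5, pp. 74–77)

## Statements

For a weight function `k` on `[a, b]` and distinct nodes `x_j = v j`, `j ∈ s` (a `Finset`), the rule
`∫_a^b k f ≈ Σ_j w_j f(x_j)` (2.5.1) is *of interpolatory type* when `w_j = ∫_a^b k ℓ_j` (2.5.6), `ℓ_j` the Lagrange
basis polynomials of the nodes (Mathlib `Lagrange.basis`).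

* `interpolatoryWeight`, `interpolatoryRule` — (2.5.6), (2.5.1)/(2.5.5).
* `interpolatoryRule_eq_integral_interpolate` — program (1): the rule is `∫ k · p_n(f; ·)` (2.5.5).
* `interpolatoryRule_eq_integral_of_degree_lt`, `sum_interpolatoryWeight_mul_pow`, `sum_interpolatoryWeight`,
  `sum_interpolatoryWeight_one` — exactness on `𝒫_n` and the moment equations (2.5.7)–(2.5.8).
* `sum_mul_eval_eq_integral_of_exact_pow` — program (2): exactness on `1, x, …, x^n` is exactness on `𝒫_n`.
* `eq_interpolatoryWeight_of_exact`, `exact_pow_iff_eq_interpolatoryWeight` — THE THEOREM of Sect. 2.5 (p. 75):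
  programs (1) and (2) yield the same numbers (uniqueness of the exact weights).
* `newtonCotesNode`, `newtonCotesWeight`, `newtonCotesRule` — the closed Newton–Cotes case (2.5.9)–(2.5.13), with
  `newtonCotesNode_injOn`, `newtonCotesRule_eq_integral_of_degree_le` (exact on `𝒫_n`), `sum_newtonCotesWeight`
  (`= b - a`), `newtonCotesWeight_one` / `newtonCotesRule_one` (`n = 1` is the trapezoidal rule,
  Mathlib `trapezoidal_integral f 1 a b`).
* `gaussLegendreWeight_eq_interpolatoryWeight`, `eq_gaussLegendreWeight_of_exact_pow` — the tree's Gauss–Legendre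
  weights (`GaussLegendreQuadrature`, Christoffel numbers `∫_{-1}^{1} ℓ_x`) ARE the interpolatory weights (2.5.6) of the
  Legendre nodes, hence (by the Theorem) the unique weights on those nodes exact in degree `< n`.

## Hypotheses

`k` interval integrable on `[a, b]`; nodes injective on `s` (`Set.InjOn v s`) where exactness / uniqueness is
claimed; `s` non-empty for the weight-sum identity. The Newton–Cotes statements are unconditional in `a`, `b`
(for `a = b` every weight is `∫_a^a = 0`).

## Proof

Program (1): expand `Lagrange.interpolate_apply`, exchange the finite sum with the interval integral. Exactness:
`Lagrange.eq_interpolate` (a polynomial of degree `< #s` is its own interpolant). Program (2) ⇒ (1): test the exact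
weights against `ℓ_j`, `ℓ_j(x_i) = δ_ij` (`Lagrange.eval_basis_self/of_ne`) — this replaces the book's Vandermonde
argument for (2.5.8). Linearity from monomials: `Polynomial.eval_eq_sum_range'`.

## Prior art in the tree

None for interpolatory / Newton–Cotes generalities with a weight function (census: the only quadrature use of
`Lagrange.basis` in the tree is `Literature.Analysis.SpecialFunctions.GaussLegendreQuadrature` —
`gaussLegendreBasis`, `gaussLegendreWeight = ∫_{-1}^{1} ℓ_x`, exactness in degree `< 2n` — which this file imports
and identifies as an instance, adding the uniqueness consequence); the specific rules live in
`MidpointTrapezoidPeanoKernel` (midpoint, trapezoid), `SimpsonRulePeanoKernel` (Simpson), `RectangularRuleError`, and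
Mathlib's `trapezoidal_integral`; this file is the common frame (weights as integrals of the Lagrange basis against a
weight function, exactness degree, uniqueness) they instantiate.

## Engine use

Anchor M51 of the QUAD-3 lane (shared numerical engines serving client cells; rigour lives in the verifiers; every
published number belongs to a client cell's ledger, not to the engines group): the exactness/uniqueness frame
against which a client verifier certifies any tabulated interpolatory weight vector (check the `n + 1` moment
equations (2.5.8), conclude the weights are (2.5.6)).

## References

* [DavisRabinowitz1984] P. J. Davis, P. Rabinowitz, *Methods of Numerical Integration*, 2nd ed., Academic Press 1984,
  Sect. 2.5 "Integration Formulas of Interpolatory Type", (2.5.1)–(2.5.13) and the Theorem on p. 75.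
-/

namespace Literature.Analysis.Quadrature

open Set MeasureTheory intervalIntegral Finset Polynomial
open scoped Real Interval

noncomputable section

variable {ι : Type*} [DecidableEq ι]

/-- The WEIGHTS OF THE INTERPOLATORY (PRODUCT) INTEGRATION RULE on the distinct nodes `v j`, `j ∈ s`, for the weight
function `k` on `[a, b]` (Davis–Rabinowitz (2.5.6)): `w_j = ∫_a^b k(x) ℓ_j(x) dx`, `ℓ_j` the Lagrange basis polynomial
of the nodes (Mathlib's `Lagrange.basis s v j`; the book's form `w(x)/(w'(x_j)(x - x_j))`, (2.5.3)–(2.5.4), is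
`Lagrange.basis_eq_prod_sub_inv_mul_nodal_div` with `Lagrange.nodalWeight_eq_eval_derivative_nodal`).
[cite: DavisRabinowitz1984, Sect. 2.5 (2.5.6)] -/
def interpolatoryWeight (k : ℝ → ℝ) (s : Finset ι) (v : ι → ℝ) (a b : ℝ) (j : ι) : ℝ :=
  ∫ x in a..b, k x * (Lagrange.basis s v j).eval x

/-- The INTERPOLATORY RULE `∫_a^b k f ≈ Σ_{j ∈ s} w_j f(x_j)` with the weights (2.5.6) (Davis–Rabinowitz (2.5.1),
(2.5.5)). [cite: DavisRabinowitz1984, Sect. 2.5 (2.5.1)] [cite: DavisRabinowitz1984, Sect. 2.5 (2.5.5)] -/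
def interpolatoryRule (k : ℝ → ℝ) (s : Finset ι) (v : ι → ℝ) (a b : ℝ) (f : ℝ → ℝ) : ℝ :=
  ∑ j ∈ s, interpolatoryWeight k s v a b j * f (v j)

omit [DecidableEq ι] in
/-- [folklore] `k · p` is interval integrable for an interval integrable weight `k` and a polynomial `p`. -/
private theorem intervalIntegrable_mul_eval {k : ℝ → ℝ} {a b : ℝ} (hk : IntervalIntegrable k volume a b)
    (p : ℝ[X]) : IntervalIntegrable (fun x => k x * p.eval x) volume a b :=
  hk.mul_continuousOn p.continuous.continuousOn

/-- **Program (1) = the rule** (Davis–Rabinowitz (2.5.5)): integrating `k` times the Lagrange interpolant of `f` at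
the nodes gives `Σ_j w_j f(x_j)` with the weights (2.5.6). [cite: DavisRabinowitz1984, Sect. 2.5 (2.5.5)] -/
theorem interpolatoryRule_eq_integral_interpolate {k : ℝ → ℝ} {a b : ℝ} (hk : IntervalIntegrable k volume a b)
    (s : Finset ι) (v : ι → ℝ) (f : ℝ → ℝ) :
    interpolatoryRule k s v a b f = ∫ x in a..b, k x * (Lagrange.interpolate s v (fun j => f (v j))).eval x := by
  have hterm : ∀ j ∈ s, IntervalIntegrable (fun x => f (v j) * (k x * (Lagrange.basis s v j).eval x)) volume a b :=
    fun j _ => (intervalIntegrable_mul_eval hk _).const_mul _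
  have e : ∀ x, k x * (Lagrange.interpolate s v (fun j => f (v j))).eval x =
      ∑ j ∈ s, f (v j) * (k x * (Lagrange.basis s v j).eval x) := by
    intro x
    rw [Lagrange.interpolate_apply, eval_finsetSum, mul_sum]
    refine sum_congr rfl fun j _ => ?_
    rw [eval_mul, eval_C]
    ring
  simp_rw [e]
  rw [intervalIntegral.integral_finsetSum hterm]
  unfold interpolatoryRule interpolatoryWeight
  refine sum_congr rfl fun j _ => ?_
  rw [intervalIntegral.integral_const_mul]
  ring

/-- **Exactness on `𝒫_n`** (Davis–Rabinowitz (2.5.7), "if the `w_j` are given by (2.5.6) then `E(f) = ∫ k (f - p_n(f))`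
vanishes for `f ∈ 𝒫_n`"): for distinct nodes and a polynomial `p` with `deg p < #s`, the interpolatory rule integrates
`k p` exactly. [cite: DavisRabinowitz1984, Sect. 2.5 (2.5.7)] -/
theorem interpolatoryRule_eq_integral_of_degree_lt {k : ℝ → ℝ} {a b : ℝ} (hk : IntervalIntegrable k volume a b)
    {s : Finset ι} {v : ι → ℝ} (hvs : Set.InjOn v s) (p : ℝ[X]) (hp : p.degree < #s) :
    interpolatoryRule k s v a b (fun x => p.eval x) = ∫ x in a..b, k x * p.eval x := by
  rw [interpolatoryRule_eq_integral_interpolate hk]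
  conv_rhs => rw [Lagrange.eq_interpolate hvs hp]

/-- **The moment equations** (Davis–Rabinowitz (2.5.8)): `Σ_j w_j x_j^m = ∫_a^b k(x) x^m dx = m_m` for `m < #s`.
[cite: DavisRabinowitz1984, Sect. 2.5 (2.5.8)] -/
theorem sum_interpolatoryWeight_mul_pow {k : ℝ → ℝ} {a b : ℝ} (hk : IntervalIntegrable k volume a b)
    {s : Finset ι} {v : ι → ℝ} (hvs : Set.InjOn v s) {m : ℕ} (hm : m < #s) :
    ∑ j ∈ s, interpolatoryWeight k s v a b j * v j ^ m = ∫ x in a..b, k x * x ^ m := by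
  have hp : (X ^ m : ℝ[X]).degree < #s := by
    rw [degree_X_pow]; exact_mod_cast hm
  have h := interpolatoryRule_eq_integral_of_degree_lt hk hvs (X ^ m) hp
  simpa [interpolatoryRule, eval_pow, eval_X] using h

/-- **Sum of the weights** (the first moment equation of (2.5.8)): `Σ_j w_j = ∫_a^b k = m_0` (non-empty node set).
[cite: DavisRabinowitz1984, Sect. 2.5 (2.5.8)] -/
theorem sum_interpolatoryWeight {k : ℝ → ℝ} {a b : ℝ} (hk : IntervalIntegrable k volume a b)
    {s : Finset ι} {v : ι → ℝ} (hvs : Set.InjOn v s) (hs : s.Nonempty) :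
    ∑ j ∈ s, interpolatoryWeight k s v a b j = ∫ x in a..b, k x := by
  have h := sum_interpolatoryWeight_mul_pow hk hvs (m := 0) (card_pos.2 hs)
  simpa using h

/-- For the weight `k ≡ 1` the weights sum to the length of the interval: `Σ_j w_j = b - a`.
[cite: DavisRabinowitz1984, Sect. 2.5 (2.5.8)] -/
theorem sum_interpolatoryWeight_one {a b : ℝ} {s : Finset ι} {v : ι → ℝ} (hvs : Set.InjOn v s)
    (hs : s.Nonempty) : ∑ j ∈ s, interpolatoryWeight (fun _ => 1) s v a b j = b - a := by
  rw [sum_interpolatoryWeight intervalIntegrable_const hvs hs, intervalIntegral.integral_const, smul_eq_mul, mul_one]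

omit [DecidableEq ι] in
/-- **Program (2): exactness on `1, x, …, x^n` is exactness on `𝒫_n`** (linearity; the step from (2.5.7) to
"`E(f) = 0` for `f ∈ 𝒫_n`"): if weights `w_j` integrate `k x^m` exactly for all `m < #s`, they integrate `k p`
exactly for every polynomial `p` with `deg p < #s`. [cite: DavisRabinowitz1984, Sect. 2.5 (2.5.7)] -/
theorem sum_mul_eval_eq_integral_of_exact_pow {k : ℝ → ℝ} {a b : ℝ} (hk : IntervalIntegrable k volume a b)
    {s : Finset ι} {v : ι → ℝ} {w : ι → ℝ}
    (hw : ∀ m < #s, ∑ j ∈ s, w j * v j ^ m = ∫ x in a..b, k x * x ^ m) (p : ℝ[X]) (hp : p.degree < #s) :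
    ∑ j ∈ s, w j * p.eval (v j) = ∫ x in a..b, k x * p.eval x := by
  rcases eq_or_ne p 0 with rfl | hp0
  · simp
  have hnat : p.natDegree < #s := (natDegree_lt_iff_degree_lt hp0).2 hp
  have e : ∀ x, p.eval x = ∑ i ∈ range #s, p.coeff i * x ^ i := fun x => eval_eq_sum_range' hnat x
  have hterm : ∀ i ∈ range #s, IntervalIntegrable (fun x => p.coeff i * (k x * x ^ i)) volume a b :=
    fun i _ => (hk.mul_continuousOn (continuous_pow i).continuousOn).const_mul _
  have e1 : ∀ j, w j * p.eval (v j) = ∑ i ∈ range #s, w j * (p.coeff i * v j ^ i) := by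
    intro j; rw [e, mul_sum]
  simp_rw [e1]
  rw [sum_comm]
  have e2 : ∀ x, k x * p.eval x = ∑ i ∈ range #s, p.coeff i * (k x * x ^ i) := by
    intro x; rw [e, mul_sum]; exact sum_congr rfl fun i _ => by ring
  simp_rw [e2]
  rw [intervalIntegral.integral_finsetSum hterm]
  refine sum_congr rfl fun i hi => ?_
  rw [intervalIntegral.integral_const_mul, ← hw i (mem_range.1 hi), mul_sum]
  exact sum_congr rfl fun j _ => by ring

/-- **Uniqueness** (Davis–Rabinowitz (2.5.7) ⇒ (2.5.6)): weights exact on `𝒫_n` ARE the interpolatory weights — test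
against the Lagrange basis polynomial `ℓ_j`, `ℓ_j(x_i) = δ_ij` (the book argues with the Vandermonde matrix of (2.5.8)).
[cite: DavisRabinowitz1984, Sect. 2.5 Theorem p. 75] -/
theorem eq_interpolatoryWeight_of_exact {k : ℝ → ℝ} {a b : ℝ} {s : Finset ι} {v : ι → ℝ} (hvs : Set.InjOn v s)
    {w : ι → ℝ} (hw : ∀ p : ℝ[X], p.degree < #s → ∑ i ∈ s, w i * p.eval (v i) = ∫ x in a..b, k x * p.eval x)
    {j : ι} (hj : j ∈ s) : w j = interpolatoryWeight k s v a b j := by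
  have hdeg : (Lagrange.basis s v j).degree < #s := by
    rw [Lagrange.degree_basis hvs hj]
    exact_mod_cast Nat.sub_lt (card_pos.2 ⟨j, hj⟩) one_pos
  have h := hw _ hdeg
  rw [sum_eq_single j (fun i hi hij => by rw [Lagrange.eval_basis_of_ne hij.symm hi]; ring)
    (fun h' => (h' hj).elim), Lagrange.eval_basis_self hvs hj, mul_one] at h
  exact h

/-- **Davis–Rabinowitz's Theorem (Sect. 2.5, p. 75): programs (1) and (2) yield the same numbers.** For distinct nodes
`x_j` (`j ∈ s`, `s` non-empty) and an interval integrable weight `k`, a weight vector `w` makes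
`Σ_j w_j f(x_j)` exact for `f = 1, x, …, x^n` (`n + 1 = #s`) if and only if `w_j = ∫_a^b k ℓ_j` for every `j`.
[cite: DavisRabinowitz1984, Sect. 2.5 Theorem p. 75] -/
theorem exact_pow_iff_eq_interpolatoryWeight {k : ℝ → ℝ} {a b : ℝ} (hk : IntervalIntegrable k volume a b)
    {s : Finset ι} {v : ι → ℝ} (hvs : Set.InjOn v s) (w : ι → ℝ) :
    (∀ m < #s, ∑ j ∈ s, w j * v j ^ m = ∫ x in a..b, k x * x ^ m) ↔
      ∀ j ∈ s, w j = interpolatoryWeight k s v a b j := by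
  constructor
  · intro hw j hj
    exact eq_interpolatoryWeight_of_exact hvs (sum_mul_eval_eq_integral_of_exact_pow hk hw) hj
  · intro hw m hm
    rw [← sum_interpolatoryWeight_mul_pow hk hvs hm]
    exact sum_congr rfl fun j hj => by rw [hw j hj]


/-! ### The closed Newton–Cotes weights (2.5.9)–(2.5.12) -/

/-- The equally spaced nodes `a + j h`, `h = (b - a)/n` ((2.5.9)–(2.5.10)). [cite: DavisRabinowitz1984, Sect. 2.5 (2.5.9)] -/
def newtonCotesNode (n : ℕ) (a b : ℝ) (j : ℕ) : ℝ := a + j * ((b - a) / n)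

/-- The CLOSED NEWTON–COTES WEIGHTS `W_{n,j} = ∫_a^b ℓ_j(x) dx`, `j = 0, …, n`, of the nodes `a + j h` with the weight
`k ≡ 1` ((2.5.11)–(2.5.13); the book's normalised `B_{nj} = n W_{n,j}/(b - a)`).
[cite: DavisRabinowitz1984, Sect. 2.5 (2.5.11)] [cite: DavisRabinowitz1984, Sect. 2.5 (2.5.12)] -/
def newtonCotesWeight (n : ℕ) (a b : ℝ) (j : ℕ) : ℝ :=
  interpolatoryWeight (fun _ => 1) (range (n + 1)) (newtonCotesNode n a b) a b j

/-- The closed `(n + 1)`-point NEWTON–COTES RULE `Σ_{j ≤ n} W_{n,j} f(a + j h)` ((2.5.11)).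
[cite: DavisRabinowitz1984, Sect. 2.5 (2.5.11)] -/
def newtonCotesRule (n : ℕ) (a b : ℝ) (f : ℝ → ℝ) : ℝ :=
  ∑ j ∈ range (n + 1), newtonCotesWeight n a b j * f (newtonCotesNode n a b j)

/-- The first node is `a` ((2.5.9)). [cite: DavisRabinowitz1984, Sect. 2.5 (2.5.9)] -/
@[simp] theorem newtonCotesNode_zero (n : ℕ) (a b : ℝ) : newtonCotesNode n a b 0 = a := by
  simp [newtonCotesNode]

/-- The last node is `a + n h = b` ((2.5.9), `n ≥ 1`). [cite: DavisRabinowitz1984, Sect. 2.5 (2.5.9)] -/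
theorem newtonCotesNode_last {n : ℕ} (hn : 0 < n) (a b : ℝ) : newtonCotesNode n a b n = b := by
  have hn' : (n : ℝ) ≠ 0 := by exact_mod_cast hn.ne'
  simp only [newtonCotesNode]
  field_simp
  ring

/-- The Newton–Cotes rule is the interpolatory rule (2.5.1) of its nodes with `k ≡ 1`.
[cite: DavisRabinowitz1984, Sect. 2.5 (2.5.11)] -/
theorem newtonCotesRule_eq_interpolatoryRule (n : ℕ) (a b : ℝ) (f : ℝ → ℝ) :
    newtonCotesRule n a b f = interpolatoryRule (fun _ => 1) (range (n + 1)) (newtonCotesNode n a b) a b f := rfl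

/-- For `a ≠ b` the Newton–Cotes nodes are distinct. [cite: DavisRabinowitz1984, Sect. 2.5 (2.5.9)] -/
theorem newtonCotesNode_injOn {a b : ℝ} (hab : a ≠ b) (n : ℕ) :
    Set.InjOn (newtonCotesNode n a b) ((Finset.range (n + 1) : Finset ℕ) : Set ℕ) := by
  rcases Nat.eq_zero_or_pos n with rfl | hn
  · intro i hi j hj _
    simp only [zero_add, Finset.coe_range, Set.mem_Iio, Nat.lt_one_iff] at hi hj
    rw [hi, hj]
  · intro i _ j _ hij
    have hh : (b - a) / n ≠ 0 := div_ne_zero (sub_ne_zero.2 (Ne.symm hab)) (by exact_mod_cast hn.ne')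
    have : (i : ℝ) = j := by
      simp only [newtonCotesNode, add_right_inj] at hij
      exact mul_right_cancel₀ hh hij
    exact_mod_cast this

/-- **The closed Newton–Cotes rule is exact on `𝒫_n`**: `Σ_{j ≤ n} W_{n,j} p(a + j h) = ∫_a^b p` for every polynomial
`p` of degree `≤ n` (interpolatory type, (2.5.7)). [cite: DavisRabinowitz1984, Sect. 2.5 (2.5.7)]
[cite: DavisRabinowitz1984, Sect. 2.5 (2.5.11)] -/
theorem newtonCotesRule_eq_integral_of_degree_le (n : ℕ) (a b : ℝ) (p : ℝ[X]) (hp : p.degree ≤ n) :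
    newtonCotesRule n a b (fun x => p.eval x) = ∫ x in a..b, p.eval x := by
  rcases eq_or_ne a b with rfl | hab
  · simp [newtonCotesRule, newtonCotesWeight, interpolatoryWeight]
  have hp' : p.degree < #(range (n + 1)) := by
    rw [card_range]
    exact lt_of_le_of_lt hp (by exact_mod_cast Nat.lt_succ_self n)
  have h := interpolatoryRule_eq_integral_of_degree_lt (k := fun _ => (1 : ℝ)) (a := a) (b := b)
    intervalIntegrable_const (newtonCotesNode_injOn hab n) p hp'
  simpa [newtonCotesRule_eq_interpolatoryRule] using h

/-- **The Newton–Cotes weights sum to `b - a`** (`Σ_k B_{nk} = n`). [cite: DavisRabinowitz1984, Sect. 2.5 (2.5.8)]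
[cite: DavisRabinowitz1984, Sect. 2.5 (2.5.11)] -/
theorem sum_newtonCotesWeight (n : ℕ) (a b : ℝ) : ∑ j ∈ range (n + 1), newtonCotesWeight n a b j = b - a := by
  rcases eq_or_ne a b with rfl | hab
  · simp [newtonCotesWeight, interpolatoryWeight]
  exact sum_interpolatoryWeight_one (newtonCotesNode_injOn hab n) ⟨0, by simp⟩

/-- **`n = 1` is the trapezoidal rule**: `W_{1,0} = W_{1,1} = (b - a)/2`. [cite: DavisRabinowitz1984, Sect. 2.5 (2.5.11)] -/
theorem newtonCotesWeight_one (a b : ℝ) :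
    newtonCotesWeight 1 a b 0 = (b - a) / 2 ∧ newtonCotesWeight 1 a b 1 = (b - a) / 2 := by
  have hr : range (1 + 1) = ({1, 0} : Finset ℕ) := by decide
  have h1 : newtonCotesNode 1 a b 1 = b := by simp [newtonCotesNode]
  have i1 : IntervalIntegrable (fun x : ℝ => x - b) volume a b := (continuous_id.sub continuous_const).intervalIntegrable a b
  have i2 : IntervalIntegrable (fun x : ℝ => x - a) volume a b := (continuous_id.sub continuous_const).intervalIntegrable a b
  constructor
  · simp only [newtonCotesWeight, interpolatoryWeight, hr, one_mul]
    rw [Lagrange.basis_pair_right (by norm_num : (1 : ℕ) ≠ 0), h1, newtonCotesNode_zero]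
    simp only [Lagrange.basisDivisor, eval_mul, eval_C, eval_sub, eval_X]
    rw [intervalIntegral.integral_const_mul, intervalIntegral.integral_sub intervalIntegral.intervalIntegrable_id
      intervalIntegrable_const, integral_id, intervalIntegral.integral_const, smul_eq_mul]
    rcases eq_or_ne a b with rfl | hab
    · simp
    · have : a - b ≠ 0 := sub_ne_zero.2 hab
      field_simp
      ring
  · simp only [newtonCotesWeight, interpolatoryWeight, hr, one_mul]
    rw [Lagrange.basis_pair_left (by norm_num : (1 : ℕ) ≠ 0), h1, newtonCotesNode_zero]
    simp only [Lagrange.basisDivisor, eval_mul, eval_C, eval_sub, eval_X]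
    rw [intervalIntegral.integral_const_mul, intervalIntegral.integral_sub intervalIntegral.intervalIntegrable_id
      intervalIntegrable_const, integral_id, intervalIntegral.integral_const, smul_eq_mul]
    rcases eq_or_ne a b with rfl | hab
    · simp
    · have : b - a ≠ 0 := sub_ne_zero.2 (Ne.symm hab)
      field_simp
      ring

/-- The two-point closed Newton–Cotes rule is Mathlib's one-panel trapezoidal rule `trapezoidal_integral f 1 a b`.
[cite: DavisRabinowitz1984, Sect. 2.5 (2.5.11)] -/
theorem newtonCotesRule_one (a b : ℝ) (f : ℝ → ℝ) : newtonCotesRule 1 a b f = trapezoidal_integral f 1 a b := by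
  obtain ⟨h0, h1⟩ := newtonCotesWeight_one a b
  have hn : newtonCotesNode 1 a b 1 = b := by simp [newtonCotesNode]
  rw [newtonCotesRule, sum_range_succ, sum_range_one, h0, h1, trapezoidal_integral_one, hn, newtonCotesNode_zero]
  ring


/-! ### Gauss–Legendre quadrature is of interpolatory type -/

section GaussLegendre

open Literature.Analysis.SpecialFunctions

/-- The tree's Gauss–Legendre weights (Christoffel numbers `λ_x = ∫_{-1}^{1} ℓ_x`, `GaussLegendreQuadrature`) are
the interpolatory weights (2.5.6) of the Legendre nodes for `k ≡ 1` on `[-1, 1]`: Gauss rules are of interpolatory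
type. [cite: DavisRabinowitz1984, Sect. 2.5 (2.5.6)] -/
theorem gaussLegendreWeight_eq_interpolatoryWeight (n : ℕ) (x : ℝ) :
    gaussLegendreWeight n x = interpolatoryWeight (fun _ => 1) (gaussLegendreNodes n) id (-1) 1 x := by
  simp [gaussLegendreWeight, gaussLegendreBasis, interpolatoryWeight]

/-- Consequently (the Theorem of Sect. 2.5): the Gauss–Legendre weights are the UNIQUE weights on the `n` Legendre
nodes that integrate `1, t, …, t^{n-1}` exactly over `[-1, 1]`. [cite: DavisRabinowitz1984, Sect. 2.5 Theorem p. 75] -/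
theorem eq_gaussLegendreWeight_of_exact_pow {n : ℕ} {w : ℝ → ℝ}
    (hw : ∀ m < n, ∑ x ∈ gaussLegendreNodes n, w x * x ^ m = ∫ t in (-1 : ℝ)..1, t ^ m) {x : ℝ}
    (hx : x ∈ gaussLegendreNodes n) : w x = gaussLegendreWeight n x := by
  have hvs : Set.InjOn (id : ℝ → ℝ) (gaussLegendreNodes n) := Set.injOn_id _
  have hw' : ∀ m < #(gaussLegendreNodes n), ∑ j ∈ gaussLegendreNodes n, w j * (id j) ^ m =
      ∫ t in (-1 : ℝ)..1, (fun _ => (1 : ℝ)) t * t ^ m := by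
    intro m hm
    rw [card_gaussLegendreNodes] at hm
    simpa using hw m hm
  rw [gaussLegendreWeight_eq_interpolatoryWeight]
  exact (exact_pow_iff_eq_interpolatoryWeight intervalIntegrable_const hvs w).1 hw' x hx

end GaussLegendre

end

end Literature.Analysis.Quadrature
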